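import Summits.NavierStokesRegularity.NavierStokesRegularity.Theorems.OddMorawetzLocal.Negative.OddMorawetzLocalRefutationDefsV
import Summits.NavierStokesRegularity.NavierStokesRegularity.Theorems.OddMorawetzOddMorawetzLocalCoeffSemantics
import HarnessLib

/-!
# The kernel check `isoCertCheck` as a matrix identity mod `p` (crux `OddMorawetzLocal`, refutation)

Stub `isoCert_mul_eq_one` of the refutation skeleton of the crux
`Summit.NavierStokesRegularity.NavierStokesRegularity.Theses.OddMorawetz.OddMorawetzLocal`
(item `stmt-NavierStokesRegularity-1376`). Pure list/index bookkeeping over Mathlib; no named facts, no definitions.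

The Boolean kernel pipeline `isoCertCheck reps iso kcols cinv p` multiplies, mod `p`, the `d × d` list-matrix of the
coefficients of the isotropic basis `isoPolyF iso[l]` at the representatives `reps[kcols[t]]` with the list-matrix
`cinv` (given by rows) and compares the result with the identity (`matMulMod`, `colsToRows`, `isIdentityList`).
We unfold this pipeline entrywise:

* `cast_foldr_zipWith` — the modular fold `foldr (fun x acc => (x + acc) % p) 0` of `zipWith (*) row col`, read in
  `ZMod p`, is the sum `∑ u < m, row[u] * col[u]` (`ZMod.natCast_mod`);
* `matMulMod_entry` — hence `isIdentityList (matMulMod M Bc p) = true` says `∑ u, M[i][u] * Bc[j][u] = δ i j` in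
  `ZMod p` for all `i, j` in range;
* `cast_toNat_emod` — the stored naturals `((x % p).toNat : ℕ)` read in `ZMod p` are the integers `x`
  (`ZMod.intCast_mod`);

and compare with the entry `(l, l')` of the matrix product in the conclusion (`Matrix.mul_apply`, `Finset.sum_range`),
where the index map `certIdx kcols reps.length d hJ` reads `kcols[t] % reps.length = kcols[t]` because the ranges
were checked by `certRangesOk` (`kcols[t] < reps.length`, `kcols.length = cinv.length = d`, rows of `cinv` of length
`d`). This is hypothesis `hC` of the landed `kernel_eq_span_of_modular_certificate`.
-/

set_option linter.dupNamespace false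
set_option autoImplicit false

namespace Summit.NavierStokesRegularity.NavierStokesRegularity.Theorems.OddMorawetz

namespace IsoCert

/-- The modular fold of `matMulMod`, read in `ZMod p`, is the sum of the products of the entries. -/
theorem cast_foldr_zipWith (p : ℕ) : ∀ (A B : List ℕ) (m : ℕ), A.length = m → B.length = m →
    (((List.zipWith (· * ·) A B).foldr (fun x acc => (x + acc) % p) 0 : ℕ) : ZMod p) =
      ∑ u ∈ Finset.range m, ((A.getD u 0 : ℕ) : ZMod p) * ((B.getD u 0 : ℕ) : ZMod p)
  | [], _, m, hA, _ => by subst hA; simp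
  | _ :: _, [], m, hA, hB => by simp at hA hB; omega
  | a :: A, b :: B, m, hA, hB => by
    obtain ⟨m', rfl⟩ : ∃ m', m = m' + 1 := ⟨A.length, by simpa using hA.symm⟩
    have hA' : A.length = m' := by simpa using hA
    have hB' : B.length = m' := by simpa using hB
    rw [List.zipWith_cons_cons, List.foldr_cons, ZMod.natCast_mod, Nat.cast_add, Nat.cast_mul,
      cast_foldr_zipWith p A B m' hA' hB', Finset.sum_range_succ']
    simp only [List.getD_cons_succ, List.getD_cons_zero]
    rw [add_comm]

/-- Unfolding `isIdentityList (matMulMod M Bc p) = true`: for `i, j` in range, `∑ u, M[i][u] * Bc[j][u] = δ i j` in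
`ZMod p` (`M` given by rows of length `m`, `Bc` by columns of length `m`). -/
theorem matMulMod_entry (M Bc : List (List ℕ)) (p n m : ℕ) (h : isIdentityList (matMulMod M Bc p) = true)
    (hM : M.length = n) (hB : Bc.length = n) (hrow : ∀ row ∈ M, row.length = m)
    (hcol : ∀ col ∈ Bc, col.length = m) (i j : ℕ) (hi : i < n) (hj : j < n) :
    ∑ u ∈ Finset.range m, (((M.getD i []).getD u 0 : ℕ) : ZMod p) * (((Bc.getD j []).getD u 0 : ℕ) : ZMod p) =
      if i = j then 1 else 0 := by
  have hlen : (matMulMod M Bc p).length = n := by simp [matMulMod, hM]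
  unfold isIdentityList at h
  simp only [List.all_eq_true, List.mem_range, decide_eq_true_eq, hlen] at h
  have h2 := h i hi j hj
  have hiM : i < M.length := hM ▸ hi
  have hjB : j < Bc.length := hB ▸ hj
  rw [List.getD_eq_getElem (matMulMod M Bc p) [] (by rw [hlen]; exact hi)] at h2
  simp only [matMulMod, List.getElem_map] at h2
  rw [List.getD_eq_getElem _ (0 : ℕ) (by rw [List.length_map]; exact hjB), List.getElem_map] at h2
  have h3 := congrArg (Nat.cast : ℕ → ZMod p) h2
  rw [cast_foldr_zipWith p _ _ m (hrow _ (List.getElem_mem hiM)) (hcol _ (List.getElem_mem hjB))] at h3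
  rw [List.getD_eq_getElem M [] hiM, List.getD_eq_getElem Bc [] hjB, h3]
  split_ifs <;> simp

/-- The stored residues read in `ZMod p`: `((x % p).toNat : ZMod p) = x`. -/
theorem cast_toNat_emod (p : ℕ) [Fact p.Prime] (x : ℤ) :
    (((x % (p : ℤ)).toNat : ℕ) : ZMod p) = (x : ZMod p) := by
  have hp : (p : ℤ) ≠ 0 := by exact_mod_cast (Fact.out : p.Prime).ne_zero
  have h1 : (((x % (p : ℤ)).toNat : ℕ) : ℤ) = x % (p : ℤ) := Int.toNat_of_nonneg (Int.emod_nonneg _ hp)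
  calc (((x % (p : ℤ)).toNat : ℕ) : ZMod p) = ((((x % (p : ℤ)).toNat : ℕ) : ℤ) : ZMod p) := (Int.cast_natCast _).symm
    _ = ((x % (p : ℤ) : ℤ) : ZMod p) := by rw [h1]
    _ = x := ZMod.intCast_mod x p

/-- The index map `certIdx` on an in-range position reads the list entry (no reduction). -/
theorem get_certIdx {α : Type} (reps : List α) (l : List ℕ) (r : ℕ) (hn : 0 < reps.length) (t : Fin r)
    (dflt : α) (ht : l.getD t.val 0 < reps.length) :
    reps.get (certIdx l reps.length r hn t) = reps.getD (l.getD t.val 0) dflt := by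
  rw [List.get_eq_getElem, List.getD_eq_getElem _ _ ht]
  simp only [certIdx, Nat.mod_eq_of_lt ht]

end IsoCert

open IsoCert

/-- **Stub `isoCert_mul_eq_one` of crux `OddMorawetzLocal` (refutation).** If the kernel check `isoCertCheck`
accepts and the index ranges are as checked by `certRangesOk`, then the `d × d` coordinate minor (columns `kcols`)
of the isotropic basis in orbit coordinates, reduced mod `p`, has the right inverse `certCd cinv p d`. -/
theorem isoCert_mul_eq_one (k : ℕ) (reps : List (List JVar)) (blocks : List (List ℕ × List ℕ × List (List ℕ)))
    (iso : List IsoDesc) (kcols : List ℕ) (cinv : List (List ℕ)) (d p : ℕ) [Fact p.Prime]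
    (hcert : isoCertCheck reps iso kcols cinv p = true)
    (hrng : certRangesOk k reps blocks kcols cinv d = true) (hd : iso.length = d) (hJ : 0 < reps.length) :
    (Matrix.of fun l l' : Fin d =>
        ((sVecD reps iso d l (certIdx kcols reps.length d hJ l') : ℤ) : ZMod p)) * certCd cinv p d = 1 := by
  -- the checked ranges
  unfold certRangesOk at hrng
  simp only [Bool.and_eq_true, List.all_eq_true, decide_eq_true_eq] at hrng
  obtain ⟨⟨⟨⟨-, hkc⟩, hkl⟩, hcl⟩, hcr⟩ := hrng
  -- the rows of the check
  set M : List (List ℕ) := iso.map fun q =>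
    kcols.map fun c => Int.toNat ((JPoly.coeffOf (isoPolyF q) (reps.getD c [])) % (p : ℤ)) with hM
  have hcheck : isIdentityList (matMulMod M (colsToRows cinv cinv.length) p) = true := hcert
  have hMl : M.length = d := by simp [hM, hd]
  have hBl : (colsToRows cinv cinv.length).length = d := by simp [colsToRows, hcl]
  have hrow : ∀ row ∈ M, row.length = d := by
    intro row hrow
    obtain ⟨q, -, rfl⟩ := List.mem_map.1 hrow
    simp [hkl]
  have hcol : ∀ col ∈ colsToRows cinv cinv.length, col.length = d := by
    intro col hcol
    simp only [colsToRows, List.mem_map, List.mem_range] at hcol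
    obtain ⟨i, -, rfl⟩ := hcol
    simp [hcl]
  ext l l'
  have hl : l.val < d := l.isLt
  have hl' : l'.val < d := l'.isLt
  have key := matMulMod_entry M (colsToRows cinv cinv.length) p d d hcheck hMl hBl hrow hcol l.val l'.val hl hl'
  have hone : (1 : Matrix (Fin d) (Fin d) (ZMod p)) l l' = if l.val = l'.val then 1 else 0 := by
    rw [Matrix.one_apply]
    by_cases h : l = l'
    · subst h; simp
    · have h' : l.val ≠ l'.val := fun e => h (Fin.ext e)
      simp [h, h']
  rw [hone, ← key, Matrix.mul_apply, Finset.sum_range]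
  refine Finset.sum_congr rfl fun t _ => ?_
  have ht : t.val < d := t.isLt
  -- the left factor: the coefficient of `isoPolyF iso[l]` at `reps[kcols[t]]`
  have hkt : kcols.getD t.val 0 < reps.length := by
    rw [List.getD_eq_getElem kcols 0 (by omega)]
    exact hkc _ (List.getElem_mem _)
  have hMi : M.getD l.val [] = kcols.map fun c =>
      Int.toNat ((JPoly.coeffOf (isoPolyF (iso.getD l.val (.poly []))) (reps.getD c [])) % (p : ℤ)) := by
    rw [List.getD_eq_getElem M [] (by omega), List.getD_eq_getElem iso (.poly []) (by omega)]
    simp [hM]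
  have hMit : (M.getD l.val []).getD t.val 0 =
      Int.toNat ((JPoly.coeffOf (isoPolyF (iso.getD l.val (.poly []))) (reps.getD (kcols.getD t.val 0) [])) %
        (p : ℤ)) := by
    rw [hMi, List.getD_eq_getElem _ (0 : ℕ) (by rw [List.length_map]; omega), List.getElem_map,
      List.getD_eq_getElem kcols 0 (by omega)]
  -- the right factor: column `l'` of `cinv`
  have hBj : (colsToRows cinv cinv.length).getD l'.val [] = cinv.map fun c => c.getD l'.val 0 := by
    rw [List.getD_eq_getElem _ [] (by omega)]
    simp [colsToRows, List.getElem_map, List.getElem_range]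
  have hBjt : ((colsToRows cinv cinv.length).getD l'.val []).getD t.val 0 = (cinv.getD t.val []).getD l'.val 0 := by
    rw [hBj, List.getD_eq_getElem _ (0 : ℕ) (by rw [List.length_map]; omega), List.getElem_map,
      List.getD_eq_getElem cinv [] (by omega)]
  rw [hMit, hBjt, cast_toNat_emod, Matrix.of_apply, sVecD, get_certIdx reps kcols d hJ t [] hkt, certCd,
    Matrix.of_apply]

end Summit.NavierStokesRegularity.NavierStokesRegularity.Theorems.OddMorawetz
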